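import Summits.ResolutionOfSingularities.ResolutionOfSingularities.Theorems.PurelyInseparableDim4JointTreeRoot
import HarnessLib

/-!
# Purely inseparable four-folds: the ROOT HOST of the v3-lite joint forest — the re-centring chart of an initial member with
# its SHIFTED coordinate reading (brick S3 (c) «joint point∘coordinate chains», part 38a; cell `res-dim4-pi`)

[OURS · counted 0] (D-0157 DOOR 2; desk WORD #66 (4)(c), #74 (g), #99 (d); frame `PIDim4.TerminationImpliesOrderReduction`,
S3 (c) v3-lite, memo `S3c-V3-DESIGN.md` Addenda 2–4; host item stmt-ResolutionOfSingularities-16155, helper). Nothing here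
proves resolution of singularities in dimension ≥ 4 / characteristic `p` — NOT here, not anywhere in this programme.

Part 8's `root_member_package` hides the re-centring chart `φ = Spec Θ_b` of an initial coordinate member `(b, S)` behind an `∃`
and records only `x_i − b_i ∈ 𝔭_{φ y} ⟺ x_i ∈ 𝔭_y`. The host of the v3-lite forest (part 38) must compare, through the SAME chart,
its waiting kids (projecting into `φ{x_i − c_i ∈ 𝔭 (i ∈ T)}`, part 35) with the OTHER root members and the isolated root
points, which are described in absolute coordinates `x_i − b′_i ∈ 𝔭`. This needs the SHIFTED reading
`x_i − (b_i + r) ∈ 𝔭_{φ y} ⟺ x_i − r ∈ 𝔭_y` and the chart itself: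

* §1 `exists_chart_recenter_shift` — part 8's `exists_chart_recenter_full` with the shifted coordinate reading;
* §2 **`root_host_package`** — the initial member `(b, S)` with its chart EXPOSED: `φ` onto (hence `φ(𝔸⁵)` closed), reading
  `(z^p + F)·𝒪 ↦ (z^p + deletePthPowers p (F(x + b)))·𝒪`, shifted coordinate reading, the closed set `c = φ(V(z, x_S))`, regular,
  snc with the empty boundary, `𝓘(c)` reading `𝓘Λ S` on `φ`, and the two coordinate descriptions of part 8.

AI-produced formalisation, weaker than expert review. bears_on: LADDER-RESOLUTION:D157-DOOR2 (res-dim4-pi · S3 (c) joint v3-lite).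
-/

set_option linter.dupNamespace false -- D-0017: single-problem summit path `Summit.<S>.<S>.…` by design

noncomputable section

open MvPolynomial Finset CategoryTheory AlgebraicGeometry Opposite TopologicalSpace
open AlgebraicGeometry.Scheme.IdealSheafData (ofIdealTop vanishingIdeal)

namespace Summit.ResolutionOfSingularities.ResolutionOfSingularities.Theorems.PIDim4

open Literature.AlgebraicGeometry.Resolution
open Literature.AlgebraicGeometry.Resolution.Hauser2010
open Literature.AlgebraicGeometry.Resolution.AffinePointBlowup (P A γ coord Wtop ξ)

namespace Equimultiple

/-! ## §1 The re-centring chart with the shifted coordinate reading -/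

section Recenter

variable {K : Type} [Field K] {p : ℕ} [hp : Fact p.Prime] [CharP K p]

/-- **ROOT CHART BY RE-CENTRING (shifted reading).** As part 8's `exists_chart_recenter_full` (translation to the rational
point `(a, b)` of `V(z^p + F)` followed by Hauser's cleaning; `φ = Spec Θ` surjective and closed), with the SHIFTED coordinate
reading `x_i − (b_i + r) ∈ 𝔭_{φ y} ⟺ x_i − r ∈ 𝔭_y` for every constant `r`.
[cite: Hauser2010, §G (cleaning of p-th power monomials)] [cite: HauserPerlega2019PRIMS, §2 (cleaning z ↦ z − F(b)^{1/p})] -/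
theorem exists_chart_recenter_shift [PerfectRing K p] (F : MvPolynomial (Fin 4) K) (a : K) (b : Fin 4 → K)
    (hab : a ^ p + MvPolynomial.eval b F = 0) {x : P 4 K}
    (hx : x.asIdeal = MvPolynomial.vanishingIdeal K {(Fin.cons a b : Fin (4 + 1) → K)}) :
    ∃ (φ : P 4 K ⟶ P 4 K) (_ : IsOpenImmersion φ), Function.Surjective φ ∧ φ (ξ 4 K) = x ∧
      (hypSheaf p F).comap φ = hypSheaf p (deletePthPowers p (PointBlowup.translate b F)) ∧
      (∀ (y : P 4 K) (i : Fin 4) (r : K),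
        (X i.succ - C (b i + r) : A 4 K) ∈ (φ y).asIdeal ↔ (X i.succ - C r : A 4 K) ∈ y.asIdeal) ∧
      ∀ T : Set (P 4 K), IsClosed T → IsClosed (φ '' T) := by
  obtain ⟨θ, h, h0, hs, hθ⟩ :=
    ChartDictionary.exists_clean_hyp_eq_deletePthPowers_pow (K := K) p 1 (PointBlowup.translate b F + C (a ^ p))
  rw [pow_one] at hθ
  have hθ' := ChartDictionary.clean_hyp p h0 hs 1 (PointBlowup.translate b F + C (a ^ p))
  rw [pow_one] at hθ'
  have hG0 : constantCoeff (PointBlowup.translate b F + C (a ^ p)) = 0 := by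
    rw [map_add, constantCoeff_C, show constantCoeff (PointBlowup.translate b F) = MvPolynomial.eval b F from
      coeff_zero_translate b F, add_comm]
    exact hab
  have hh0 : constantCoeff h = 0 := by
    have h1 : PointBlowup.translate b F + C (a ^ p) + h ^ p =
        deletePthPowers p (PointBlowup.translate b F + C (a ^ p)) := hyp_injective (hθ'.symm.trans hθ)
    have h2 := congrArg constantCoeff h1
    rw [map_add, hG0, zero_add, constantCoeff_deletePthPowers, map_pow] at h2
    exact pow_eq_zero_iff (hp.out.ne_zero) |>.mp h2
  have hGhyp : (X 0 ^ p + C (a ^ p) + rename Fin.succ (PointBlowup.translate b F) : A 4 K) =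
      hyp p (PointBlowup.translate b F + C (a ^ p)) := by
    rw [hyp, map_add, rename_C, add_assoc, add_comm (C (a ^ p))]
  let τ : A 4 K ≃ₐ[K] A 4 K := translateEquiv (Fin.cons a b : Fin (4 + 1) → K)
  let Θ : A 4 K ≃ₐ[K] A 4 K := τ.trans θ
  have hτ : ∀ g : A 4 K, τ g = PointBlowup.translate (Fin.cons a b : Fin (4 + 1) → K) g := fun g => rfl
  have hΘ0 : Θ (X 0) = X 0 + rename Fin.succ (h + C a) := by
    change θ (τ (X 0)) = _
    rw [hτ, PointBlowup.translate, aeval_X, Fin.cons_zero, map_add, h0, show θ (C a) = C a from θ.commutes a,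
      map_add, rename_C, add_assoc]
  have hΘs : ∀ i : Fin 4, Θ (X i.succ) = X i.succ + C (b i) := by
    intro i
    change θ (τ (X i.succ)) = _
    rw [hτ, PointBlowup.translate, aeval_X, Fin.cons_succ, map_add, hs i, show θ (C (b i)) = C (b i) from
      θ.commutes (b i)]
  have hΘF : Θ (hyp p F) = hyp p (deletePthPowers p (PointBlowup.translate b F)) := by
    change θ (τ (hyp p F)) = _
    rw [hτ, translate_hyp, hGhyp, hθ, deletePthPowers_add_C]
  haveI := isOpenImmersion_specMap_algEquiv Θ
  haveI : IsIso (CommRingCat.ofHom (Θ : A 4 K →+* A 4 K)) :=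
    (inferInstance : IsIso Θ.toRingEquiv.toCommRingCatIso.hom)
  refine ⟨Spec.map (CommRingCat.ofHom (Θ : A 4 K →+* A 4 K)), inferInstance,
    (Spec.map (CommRingCat.ofHom (Θ : A 4 K →+* A 4 K))).surjective, ?_, ?_, fun y i r => ?_,
    fun T hT => (Spec.map (CommRingCat.ofHom (Θ : A 4 K →+* A 4 K))).isClosedMap _ hT⟩
  · apply PrimeSpectrum.ext
    rw [specMap_algEquiv_ξ_asIdeal Θ (h + C a) b hΘ0 hΘs, hx, map_add, hh0, constantCoeff_C, zero_add]
  · rw [ChartDictionary.comap_hypSheaf_specMap, show (Θ : A 4 K →+* A 4 K) (hyp p F) = Θ (hyp p F) from rfl, hΘF]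
    rfl
  · rw [Spec.map_apply, PrimeSpectrum.comap_asIdeal, Ideal.mem_comap, CommRingCat.hom_ofHom]
    change Θ (X i.succ - C (b i + r)) ∈ y.asIdeal ↔ _
    have hsub : (X i.succ + C (b i) - C (b i + r) : A 4 K) = X i.succ - C r := by rw [C_add]; ring
    rw [map_sub, hΘs i, show Θ (C (b i + r)) = C (b i + r) from Θ.commutes (b i + r), hsub]

end Recenter

/-! ## §2 The host package with its chart exposed -/

section RootHost

variable {K : Type} [Field K] {p : ℕ} [hp : Fact p.Prime] [CharP K p]

/-- **ROOT HOST PACKAGE.** `K = K̄` of characteristic `p`, `(b, S)` an initial coordinate member of `z^p + F` (`V(z, x_S)`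
Hironaka-permissible for `z^p + deletePthPowers p (F(x + b))`). There are the re-centring chart `φ : 𝔸⁵ → 𝔸⁵` — an open
immersion which is ONTO, reading `(z^p + F)·𝒪` as `(z^p + deletePthPowers p (F(x + b)))·𝒪`, with the shifted coordinate reading
`x_i − (b_i + r) ∈ 𝔭_{φ y} ⟺ x_i − r ∈ 𝔭_y` — and the closed set `c = φ(V(z, x_S))` (the translated coordinate subspace of the
hypersurface), regular, snc with the empty boundary, `𝓘(c)` reading `𝓘Λ S` on `φ`, whose points have `x_i − b_i ∈ 𝔭`
(`i ∈ S`) and which contains every closed point of the hypersurface with `x_i − b_i ∈ 𝔭` (`i ∈ S`). Part 8's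
`root_member_package` with the chart exposed, for the HOST of the v3-lite forest.
[cite: HauserPerlega2019PRIMS, §2 (permissible centres P = (z, x_i : i ∈ Γ))] [cite: Hauser2010, §G] -/
theorem root_host_package [IsAlgClosed K] [DecidableEq K] (F : MvPolynomial (Fin 4) K) (b : Fin 4 → K)
    {S : Finset (Fin 4)} (hS : IsPermissibleCentre p S (deletePthPowers p (PointBlowup.translate b F))) :
    ∃ (φ : P 4 K ⟶ P 4 K) (_ : IsOpenImmersion φ) (c : Closeds (P 4 K)),
      Function.Surjective φ ∧
      (hypSheaf p F).comap φ = hypSheaf p (deletePthPowers p (PointBlowup.translate b F)) ∧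
      (∀ (y : P 4 K) (i : Fin 4) (r : K),
        (X i.succ - C (b i + r) : A 4 K) ∈ (φ y).asIdeal ↔ (X i.succ - C r : A 4 K) ∈ y.asIdeal) ∧
      (c : Set (P 4 K)) = φ '' (AffineCoordBlowup.CΛ 4 K (insert 0 (Fin.succ '' (S : Set (Fin 4)))) : Set (P 4 K)) ∧
      Scheme.IsRegular (vanishingIdeal c).subscheme ∧
      HasSNCWith ((⟨hypSheaf p F, [], p⟩ : MarkedIdeal (P 4 K)).boundary) (vanishingIdeal c) ∧
      (vanishingIdeal c).comap φ = AffineCoordBlowup.𝓘Λ 4 K (insert 0 (Fin.succ '' (S : Set (Fin 4)))) ∧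
      (∀ z : P 4 K, z ∈ (c : Set (P 4 K)) → ∀ i ∈ S, (X i.succ - C (b i) : A 4 K) ∈ z.asIdeal) ∧
      (∀ z : P 4 K, IsClosed ({z} : Set (P 4 K)) → (1 : ℕ∞) ≤ idealOrder (hypSheaf p F) z →
        (∀ i ∈ S, (X i.succ - C (b i) : A 4 K) ∈ z.asIdeal) → z ∈ (c : Set (P 4 K))) := by
  haveI : PerfectRing K p := PerfectRing.ofSurjective K p fun x => IsAlgClosed.exists_pow_nat_eq x hp.out.pos
  -- the rational point `(a, b)` of the hypersurface and its re-centring chart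
  obtain ⟨a, hab, -⟩ := existsUnique_pow_add_eq_zero (K := K) (p := p) (MvPolynomial.eval b F)
  let x : P 4 K := ⟨MvPolynomial.vanishingIdeal K {(Fin.cons a b : Fin (4 + 1) → K)}, inferInstance⟩
  obtain ⟨φ, _, hsurj, -, hMφ, hcoord', hclosedMap⟩ := exists_chart_recenter_shift (p := p) F a b hab (x := x) rfl
  have hcoord : ∀ (y : P 4 K) (i : Fin 4), (X i.succ - C (b i) : A 4 K) ∈ (φ y).asIdeal ↔ (X i.succ : A 4 K) ∈ y.asIdeal := by
    intro y i
    have h := hcoord' y i 0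
    rwa [add_zero, C_0, sub_zero] at h
  set Λ : Set (Fin (4 + 1)) := insert 0 (Fin.succ '' (S : Set (Fin 4))) with hΛ
  have hT : IsClosed (φ '' (AffineCoordBlowup.CΛ 4 K Λ : Set (P 4 K))) := hclosedMap _ (AffineCoordBlowup.CΛ 4 K Λ).isClosed
  set c : Closeds (P 4 K) := closureImage φ ((AffineCoordBlowup.𝓘Λ 4 K Λ).support : Set (P 4 K)) with hc
  have hcoe : (c : Set (P 4 K)) = φ '' (AffineCoordBlowup.CΛ 4 K Λ : Set (P 4 K)) := by
    rw [hc, coe_closureImage, AffineCoordBlowup.support_𝓘Λ, hT.closure_eq]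
  have hE₀ : HasSNC ((⟨hypSheaf p F, [], p⟩ : MarkedIdeal (P 4 K)).boundary) :=
    hasSNC_nil_of_isRegular (Literature.AlgebraicGeometry.Hironaka2017.Lib.AffinePointBlowupLSB.isRegular_Z 4 K)
  refine ⟨φ, inferInstance, c, hsurj, hMφ, hcoord', hcoe, ChartDictionary.isRegular_globalCentre φ hT,
    ChartDictionary.hasSNCWith_globalCentre φ hT hE₀ (ChartDictionary.hasSNCWith_nil_𝓘Λ Λ),
    by rw [hc]; exact ChartDictionary.comap_globalCentre φ Λ, fun z hz i hi => ?_, fun z hzc hord hzS => ?_⟩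
  · -- points of the member have `x_i = b_i`, `i ∈ S`
    rw [hcoe] at hz
    obtain ⟨y, hy, rfl⟩ := hz
    exact (hcoord y i).mpr ((AffineCoordBlowup.mem_CΛ_iff' 4 K Λ y).mp hy i.succ
      (ChartDictionary.succ_mem_centreVars hi))
  · -- closed points of the hypersurface with `x_i = b_i` (`i ∈ S`) lie on the member
    rw [hcoe]
    obtain ⟨y, rfl⟩ := hsurj z
    refine ⟨y, ?_, rfl⟩
    have hyc : IsClosed ({y} : Set (P 4 K)) := isClosed_singleton_of_isOpenImmersion_eq φ y hzc rfl
    obtain ⟨a', b', hy⟩ := exists_eq_vanishingIdeal_cons_of_isClosed hyc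
    have hyS : ∀ i ∈ S, b' i = 0 := fun i hi =>
      (X_succ_mem_asIdeal_iff i a' b' hy).mp ((hcoord y i).mp (hzS i hi))
    -- on the chart the hypersurface reads `z^p + G_b`, `G_b ∈ (x_S)^p`; so `a' = 0`
    have hord' : (1 : ℕ∞) ≤ idealOrder (hypSheaf p (deletePthPowers p (PointBlowup.translate b F))) y := by
      rw [← hMφ, idealOrder_comap_of_isOpenImmersion]
      exact hord
    have h1 := (natCast_le_idealOrder_hypSheaf_iff (p := p) (deletePthPowers p (PointBlowup.translate b F)) hy 1).mp
      (by exact_mod_cast hord')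
    rw [Nat.cast_one, translate_hyp, one_le_ordZero_iff, map_add, map_add, map_pow, constantCoeff_X,
      zero_pow hp.out.ne_zero, zero_add, constantCoeff_C, constantCoeff_rename,
      show constantCoeff (PointBlowup.translate b' (deletePthPowers p (PointBlowup.translate b F))) =
        MvPolynomial.eval b' (deletePthPowers p (PointBlowup.translate b F)) from coeff_zero_translate b' _,
      eval_eq_zero_of_one_le_ordAlong (le_trans (by exact_mod_cast hp.out.one_lt.le) hS.2) hyS, add_zero] at h1
    have ha' : a' = 0 := pow_eq_zero_iff hp.out.ne_zero |>.mp h1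
    exact mem_CΛ_of_cons hy ha' hyS

end RootHost

end Equimultiple

end Summit.ResolutionOfSingularities.ResolutionOfSingularities.Theorems.PIDim4

end
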